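import Summits.QuantumFields.YangMills.Theorems.UniversalDetectorMirrorPositivity
import Summits.QuantumFields.YangMills.Theorems.LangevinControlUVOSLegsFromFemtoAndGapStubAssemblyMomentWeights
import Literature.MathematicalPhysics.QuantumFieldTheory.SpeciesTimeReflection
import HarnessLib

/-!
# Route `F4SubCurvatureDoor`, crux `SubCurvatureClause` ⟨stmt-QuantumFields-23763⟩ — AXIS DOMINATION of the MIXED (density × reflected
# density) lattice two-point kernel by the on-axis coupling `lCC(Q^θ, Q, ·)` alone

Helper file (`--supports stmt-QuantumFields-23763 --as helper`; free-hands seat `ym-line-frs-p2` g19; the reflection-positivity step of the soft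
stub `LatticeToAxis` of the crux idea «rp-moebius-ladder», SINGLE ORDER `(Q^θ, Q)` as the skeleton's `axisG` (ym-idea-3 g24/g25)).  Definition-free,
0 sorry, standard axioms.  No item is closed; no summit, no crux and no mass gap is proved by this file.

WHAT.  On the odd torus `2L+1` (`β ≥ 0`) write `κ(s) := Cov_T(Q^θ_0, Q_s) = E_T[dens 0 ∘ Θ₀ · dens s] − E_T[dens 0] E_T[dens s]` for the MIXED
kernel (`Θ₀ = cfgReflect`, `Q^θ = r.curvature.timeReflect`).  Then

* `lcc_eq_mixedKernel` (§1): `latticeConnectedCorr r.ρ β (2L+1) Q^θ Q n = κ(n e₀)` — the on-axis coupling of the skeleton IS the mixed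
  kernel on the time axis;
* `mixedCov_translate` (§1): `Cov_T(dens w ∘ Θ₀, dens v) = κ(v − θ₀ w)` (translation invariance of Wilson's torus measure, `Θ₀ ∘ τ_u = τ_{θ₀u} ∘ Θ₀`);
* `sq_mixedCov_le` (§2): the reflection-positivity Cauchy–Schwarz of the odd torus (✓`CurvatureKernel.OddTorusCovCauchySchwarz`, via the link-set
  description of the closed non-negative half) for the pair `F = dens w ∘ lift`, `H = dens v ∘ lift` with `0 ≤ w₀, v₀ ≤ L − 2`:
  `Cov_T(dens w ∘ Θ₀, dens v)² ≤ Cov_T(dens w ∘ Θ₀, dens w) · Cov_T(dens v ∘ Θ₀, dens v)`, both factors `≥ 0`;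
* ★ `sq_mixedKernel_le_lcc_mul_lcc` (§3): for every separation `s` with `s₀ = t + t'`, `t + 2 ≤ L`, `t' + 2 ≤ L`:
  `κ(s)² ≤ lCC(Q^θ,Q,2t') · lCC(Q^θ,Q,2t)` with both axis factors `≥ 0` — BOTH in the `(Q^θ, Q)` order (no order swap is needed because
  the off-diagonal Gram entry of two DENSITY insertions is the mixed kernel).

[cite: OsterwalderSeiler1978, §2]; [cite: FrohlichIsraelLiebSimon1978, Thm. 2.1].

HONEST LABEL: a soft lattice lemma; the crux content (`MoebiusRow`, `CrossoverDecay`) is untouched; ⟨23763⟩, ⟨23036⟩ open; the Yang–Mills mass gap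
is NOT proved; no summit is proved by a line.
-/

set_option autoImplicit false

noncomputable section

open MeasureTheory Filter Topology
open Literature.MathematicalPhysics.QuantumFieldTheory Literature.MathematicalPhysics.QuantumLattice
open Literature.Probability.LatticeModels (Site)
open Summit.QuantumFields.YangMills.Cruxes.OSLegsFromFemtoAndGap.DlrCollarTransfer
open Summit.QuantumFields.YangMills.Cruxes.OSLegsFromFemtoAndGap.DlrCollarTransfer.StubLower (exists_abs_dens_le)
open Summit.QuantumFields.YangMills.Theorems.OSLegsFromFemtoAndGap (torusE_dens_eq_wilsonTorusMean)
open Summit.QuantumFields.YangMills.Cruxes.NT.MarkovMirror (dependsOn_strictHalf_of_posHalf dependsOn_posHalf_of_window)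
open Summit.QuantumFields.YangMills.Cruxes.NT.ConjugateResponse (torusE_comp_cfgReflect)
open Summit.QuantumFields.YangMills.Cruxes.UniversalDetectorPlaneTight (torusE_configShift_neg dens_configShift_neg)
open Summit.QuantumFields.YangMills.Theorems.CurvatureKernel (OddTorusCovCauchySchwarz)

namespace Summit.QuantumFields.YangMills.Theorems.F4SubCurvatureDoorSubCurvatureClauseMixedAxisDomination

variable {G : Type} [Group G] [TopologicalSpace G] [IsTopologicalGroup G] [CompactSpace G]
  [MeasurableSpace G] [BorelSpace G]

/-! ## §1 The mixed kernel: the on-axis coupling and translation invariance -/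

/-- `dens 0` is the action density itself. [bookkeeping] -/
theorem dens_zero_apply (r : LatticeRep G) (V : LGConfig 4 G) : dens G r 0 V = r.curvature.F V := by
  unfold dens
  congr 1
  funext e
  simp [configShift_apply]

/-- `dens (n e₀)` is the action density translated by `n` lattice units in time. [bookkeeping] -/
theorem dens_single_apply (r : LatticeRep G) (n : ℕ) (V : LGConfig 4 G) :
    dens G r (Pi.single 0 (n : ℤ)) V = r.curvature.F (configShift (-Pi.single 0 (n : ℤ)) V) := rfl

/-- **The on-axis coupling of the skeleton is the mixed kernel on the time axis**:
`latticeConnectedCorr r.ρ β (2L+1) Q^θ Q n = E_T[dens 0 ∘ Θ₀ · dens (n e₀)] − E_T[dens 0] E_T[dens (n e₀)]`. [cite: OsterwalderSeiler1978, §2] -/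
theorem lcc_eq_mixedKernel (r : LatticeRep G) (β : ℝ) (L n : ℕ) :
    latticeConnectedCorr r.ρ β (2 * L + 1) r.curvature.timeReflect.F r.curvature.F n =
      torusE G r β L (fun V => dens G r 0 (cfgReflect V) * dens G r (Pi.single 0 (n : ℤ)) V) -
        torusE G r β L (dens G r 0) * torusE G r β L (dens G r (Pi.single 0 (n : ℤ))) := by
  have hmean : torusE G r β L (dens G r (Pi.single 0 (n : ℤ))) = torusE G r β L (dens G r 0) := by
    rw [torusE_dens_eq_wilsonTorusMean, torusE_dens_eq_wilsonTorusMean]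
  rw [hmean]
  have e1 : ∀ U : GaugeConfig 4 (2 * L + 1) G,
      r.curvature.timeReflect.F (torusLift (2 * L + 1) U) = dens G r 0 (cfgReflect (torusLift (2 * L + 1) U)) := by
    intro U; rw [LocalGaugeObservable.timeReflect_F, dens_zero_apply]
  have e2 : ∀ U : GaugeConfig 4 (2 * L + 1) G,
      r.curvature.F (configShift (-Pi.single 0 (n : ℤ)) (torusLift (2 * L + 1) U)) =
        dens G r (Pi.single 0 (n : ℤ)) (torusLift (2 * L + 1) U) := fun U => rfl
  have e3 : ∀ U : GaugeConfig 4 (2 * L + 1) G,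
      r.curvature.F (torusLift (2 * L + 1) U) = dens G r 0 (torusLift (2 * L + 1) U) := fun U => (dens_zero_apply r _).symm
  have hB : ∫ U, dens G r 0 (cfgReflect (torusLift (2 * L + 1) U)) ∂(wilsonMeasure (d := 4) (L := 2 * L + 1) r.ρ β) =
      torusE G r β L (dens G r 0) := by
    have h := torusE_comp_cfgReflect G r β L (dens G r 0)
    unfold torusE at h
    exact h
  unfold latticeConnectedCorr
  simp_rw [e1, e2, e3]
  rw [hB]
  unfold torusE
  rfl

/-- **Translation rule of the mixed covariance**: `Cov_T(dens w ∘ Θ₀, dens v) = κ(v − θ₀w)` where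
`κ(s) = E_T[dens 0 ∘ Θ₀ · dens s] − E_T[dens 0] E_T[dens s]`. [folklore] -/
theorem mixedCov_translate (r : LatticeRep G) (β : ℝ) (L : ℕ) (w v : Site 4) :
    torusE G r β L (fun V => dens G r w (cfgReflect V) * dens G r v V) - torusE G r β L (dens G r w) * torusE G r β L (dens G r v) =
      torusE G r β L (fun V => dens G r 0 (cfgReflect V) * dens G r (v - siteReflect w) V) -
        torusE G r β L (dens G r 0) * torusE G r β L (dens G r (v - siteReflect w)) := by
  have hmeans : ∀ x : Site 4, torusE G r β L (dens G r x) = torusE G r β L (dens G r 0) := fun x => by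
    rw [torusE_dens_eq_wilsonTorusMean, torusE_dens_eq_wilsonTorusMean]
  -- translate by `u = θ₀ w` (pattern of ✓`UniversalDetectorPlaneTight.cov_dens_translate`)
  have hcfg : ∀ V : LGConfig 4 G, cfgReflect (configShift (-siteReflect w) V) = configShift (-w) (cfgReflect V) := by
    intro V
    rw [cfgReflect_configShift, siteReflect_neg, siteReflect_siteReflect]
  have e2 : ∀ V : LGConfig 4 G, dens G r w (cfgReflect V) = dens G r 0 (cfgReflect (configShift (-siteReflect w) V)) := by
    intro V
    rw [hcfg V]
    have h := dens_configShift_neg r w w (cfgReflect V)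
    rw [sub_self] at h
    exact h.symm
  have e3 : ∀ V : LGConfig 4 G, dens G r v V = dens G r (v - siteReflect w) (configShift (-siteReflect w) V) :=
    fun V => (dens_configShift_neg r (siteReflect w) v V).symm
  have h1 : (fun V => dens G r w (cfgReflect V) * dens G r v V) =
      fun V => dens G r 0 (cfgReflect (configShift (-siteReflect w) V)) *
        dens G r (v - siteReflect w) (configShift (-siteReflect w) V) := by
    funext V; rw [e2, e3]
  rw [hmeans w, hmeans v, hmeans (v - siteReflect w), h1,
    torusE_configShift_neg r β L (fun W => dens G r 0 (cfgReflect W) * dens G r (v - siteReflect w) W) (siteReflect w)]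

/-! ## §2 Reflection-positivity Cauchy–Schwarz for two density insertions -/

/-- A density insertion at a site of time `0 ≤ w₀ ≤ L − 2`, read through the periodic lift, is an observable of the closed non-negative half of
the odd torus `2L+1`. [folklore] -/
theorem dependsOn_dens_posHalf (r : LatticeRep G) (L : ℕ) (w : Site 4) (hw : 0 ≤ w 0 ∧ w 0 + 2 ≤ (L : ℤ)) :
    DependsOn (fun U : GaugeConfig 4 (2 * L + 1) G => dens G r w (torusLift (2 * L + 1) U))
      {e : Edge 4 (2 * L + 1) | (e.1 0).val ≤ L ∧ ((e.1.shift e.2) 0).val ≤ L} := by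
  refine dependsOn_posHalf_of_window (G := G) L (isCylinder_dens r w) fun e he => ?_
  have h0 := near_of_mem_supp_dens r he 0
  constructor <;> omega

/-- **RP Cauchy–Schwarz for two density insertions** at sites of times `0 ≤ w₀, v₀ ≤ L − 2` on the odd torus `2L+1`, `β ≥ 0`:
`Cov_T(dens w ∘ Θ₀, dens v)² ≤ Cov_T(dens w ∘ Θ₀, dens w) · Cov_T(dens v ∘ Θ₀, dens v)` and both factors are `≥ 0`
(✓`CurvatureKernel.OddTorusCovCauchySchwarz`). [cite: OsterwalderSeiler1978, §2] [cite: FrohlichIsraelLiebSimon1978, Thm. 2.1] -/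
theorem sq_mixedCov_le (r : LatticeRep G) {β : ℝ} (hβ : 0 ≤ β) {L : ℕ} (hL : 1 ≤ L) (w v : Site 4)
    (hw : 0 ≤ w 0 ∧ w 0 + 2 ≤ (L : ℤ)) (hv : 0 ≤ v 0 ∧ v 0 + 2 ≤ (L : ℤ)) :
    0 ≤ torusE G r β L (fun V => dens G r w (cfgReflect V) * dens G r w V) - torusE G r β L (dens G r w) * torusE G r β L (dens G r w) ∧
    0 ≤ torusE G r β L (fun V => dens G r v (cfgReflect V) * dens G r v V) - torusE G r β L (dens G r v) * torusE G r β L (dens G r v) ∧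
    (torusE G r β L (fun V => dens G r w (cfgReflect V) * dens G r v V) - torusE G r β L (dens G r w) * torusE G r β L (dens G r v)) ^ 2 ≤
      (torusE G r β L (fun V => dens G r w (cfgReflect V) * dens G r w V) - torusE G r β L (dens G r w) * torusE G r β L (dens G r w)) *
        (torusE G r β L (fun V => dens G r v (cfgReflect V) * dens G r v V) -
          torusE G r β L (dens G r v) * torusE G r β L (dens G r v)) := by
  haveI := r.secondCountableTopology
  obtain ⟨C, -, hC⟩ := exists_abs_dens_le G r
  set F : GaugeConfig 4 (2 * L + 1) G → ℝ := fun U => dens G r w (torusLift (2 * L + 1) U) with hF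
  set H : GaugeConfig 4 (2 * L + 1) G → ℝ := fun U => dens G r v (torusLift (2 * L + 1) U) with hH
  have hFm : Measurable F := ((continuous_dens r w).comp (continuous_torusLift _)).measurable
  have hHm : Measurable H := ((continuous_dens r v).comp (continuous_torusLift _)).measurable
  have hFb : ∃ K : ℝ, ∀ U, |F U| ≤ K := ⟨C, fun U => hC _ _⟩
  have hHb : ∃ K : ℝ, ∀ U, |H U| ≤ K := ⟨C, fun U => hC _ _⟩
  have hFd := dependsOn_strictHalf_of_posHalf hL (dependsOn_dens_posHalf r L w hw)
  have hHd := dependsOn_strictHalf_of_posHalf hL (dependsOn_dens_posHalf r L v hv)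
  obtain ⟨h1, h2, h3⟩ := OddTorusCovCauchySchwarz G r.N r.ρ r.continuous β hβ L hL F H hFm hHm hFb hHb hFd hHd
  unfold torusE
  simp only [hF, hH, torusLift_negReflect] at h1 h2 h3
  exact ⟨h1, h2, h3⟩

/-! ## §3 ★ Axis domination of the mixed kernel in the `(Q^θ, Q)` order -/

/-- ★ **AXIS DOMINATION OF THE MIXED KERNEL, single order.**  On the odd torus `2L+1` at `β ≥ 0`, for natural numbers `t, t'` with
`t + 2 ≤ L`, `t' + 2 ≤ L` and every separation `s` with time component `s₀ = t + t'`: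
`κ(s)² ≤ lCC(Q^θ,Q,2t') · lCC(Q^θ,Q,2t)` with `0 ≤ lCC(Q^θ,Q,2t')`, `0 ≤ lCC(Q^θ,Q,2t)`, where
`κ(s) = E_T[dens 0 ∘ Θ₀ · dens s] − E_T[dens 0] E_T[dens s]` is the mixed kernel and `lCC = latticeConnectedCorr r.ρ β (2L+1) Q^θ Q`.
[cite: OsterwalderSeiler1978, §2] -/
theorem sq_mixedKernel_le_lcc_mul_lcc (r : LatticeRep G) {β : ℝ} (hβ : 0 ≤ β) (L t t' : ℕ) (ht : t + 2 ≤ L) (ht' : t' + 2 ≤ L)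
    (s : Site 4) (hs : s 0 = (t : ℤ) + t') :
    0 ≤ latticeConnectedCorr r.ρ β (2 * L + 1) r.curvature.timeReflect.F r.curvature.F (2 * t') ∧
    0 ≤ latticeConnectedCorr r.ρ β (2 * L + 1) r.curvature.timeReflect.F r.curvature.F (2 * t) ∧
    (torusE G r β L (fun V => dens G r 0 (cfgReflect V) * dens G r s V) - torusE G r β L (dens G r 0) * torusE G r β L (dens G r s)) ^ 2 ≤
      latticeConnectedCorr r.ρ β (2 * L + 1) r.curvature.timeReflect.F r.curvature.F (2 * t') *
        latticeConnectedCorr r.ρ β (2 * L + 1) r.curvature.timeReflect.F r.curvature.F (2 * t) := by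
  have hL : 1 ≤ L := by omega
  -- the Gram pair: `w = t' e₀`, `v = s − t' e₀` (so that `v − θ₀ w = s`)
  set w : Site 4 := Pi.single 0 (t' : ℤ) with hw
  set v : Site 4 := s - Pi.single 0 (t' : ℤ) with hv
  have hw0 : w 0 = t' := by simp [hw]
  have hv0 : v 0 = t := by simp [hv, hs]
  have hθw : siteReflect w = -w := by
    funext k
    rw [siteReflect_apply_ite]
    by_cases hk : k = 0
    · subst hk; simp
    · simp [hk, hw]
  have hvw : v - siteReflect w = s := by rw [hθw, hv, sub_neg_eq_add, sub_add_cancel]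
  -- `x − θ₀x = 2x₀ e₀` (the landed `CurvatureKernel.AxisDom.sub_siteReflect_eq_single` lives in a module whose olean is not served; inlined)
  have hsub : ∀ x : Site 4, x - siteReflect x = Pi.single 0 (2 * x 0) := by
    intro x
    funext k
    rw [Pi.sub_apply, siteReflect_apply_ite]
    by_cases hk : k = 0
    · subst hk; simp; ring
    · simp [hk]
  have hww : w - siteReflect w = Pi.single 0 ((2 * t' : ℕ) : ℤ) := by
    rw [hsub, hw0]; push_cast; ring_nf
  have hvv : v - siteReflect v = Pi.single 0 ((2 * t : ℕ) : ℤ) := by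
    rw [hsub, hv0]; push_cast; ring_nf
  obtain ⟨h1, h2, h3⟩ := sq_mixedCov_le r hβ hL w v ⟨by rw [hw0]; positivity, by rw [hw0]; omega⟩
    ⟨by rw [hv0]; positivity, by rw [hv0]; omega⟩
  rw [mixedCov_translate r β L w w, hww, ← lcc_eq_mixedKernel] at h1 h3
  rw [mixedCov_translate r β L v v, hvv, ← lcc_eq_mixedKernel] at h2 h3
  rw [mixedCov_translate r β L w v, hvw] at h3
  exact ⟨h1, h2, h3⟩

end Summit.QuantumFields.YangMills.Theorems.F4SubCurvatureDoorSubCurvatureClauseMixedAxisDomination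

end
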